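import Literature.Topology.FourManifolds.OpenCollar
import Literature.Topology.FourManifolds.BoundaryFlowout
import Literature.Topology.FourManifolds.SPC4MorseExistence
import Literature.Topology.FourManifolds.RegularSlabField
import HarnessLib

/-!
# Existence of long open collars on compact manifolds with boundary (all dimensions)

Topic `Literature/Topology/FourManifolds` (fact seat
`provefact-Literature.Topology.FourManifolds.exists_isBoundaryGluing`; companion of `OpenCollar.lean`).
Everything here is proved.

On a compact `C^∞` manifold with boundary `M` of dimension `n + 1 ≥ 1` (model `𝓡∂ (n + 1)`), every
boundary datum `b` with nonempty boundary admits a long open collar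
`Literature.Topology.FourManifolds.BoundaryData.OpenCollar` (Bröcker–Jänich, *Introduction to Differential
Topology* (1982), (13.6): "if we so wish, we can map `∂M × ℝ₊` onto a neighbourhood of `∂M`";
Milnor, *Lectures on the h-cobordism theorem* (1965), proof of Thm. 3.4).  The proof is the
tree's flow-out construction of Milnor's collar (`BoundaryFlowout.lean`: boundary-defining function
`f`, vector field `ξ` with `ξ(f) = 1` near `∂M`, flow-out `Fl` with explicit inverse
`z ↦ (ret z, f z)`), which is dimension-general, re-run with the parameter stretched from `[0, a)`
to `[0, ∞)` by `s ↦ a s / (1 + s)`: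

* `Literature.Topology.FourManifolds.FlowoutInput.nonempty_of_compactSpace` — flow-out input exists on a compact manifold with
  boundary of *every* dimension `n + 1 ≥ 1` (the tree's `nonempty_flowoutInput` of
  `CollarTheorem.lean` is the case `n + 2`; same proof: Milnor's Lemma 2.6,
  `exists_contMDiff_eq_one_on_boundary`, and `exists_contMDiffSection_mlineDeriv_eq_one_on`).
* `Literature.Topology.FourManifolds.FlowoutInput.Cover.openCollar` — the long open collar
  `toFun x s = Fl (incl x) (a s / (1 + s))`, `proj z = incl⁻¹ (ret z)`, `height z = f z / (a - f z)`
  on `region = {f < a}`.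
* `Literature.Topology.FourManifolds.BoundaryData.nonempty_openCollar` — the conclusion.

## References

* T. Bröcker, K. Jänich, *Introduction to Differential Topology*, CUP (1982), (13.6).
  [BrockerJanich1982]
* J. Milnor, *Lectures on the h-cobordism theorem*, Princeton (1965), Lemma 2.6 and proof of
  Thm. 3.4. [MilnorHCobordism1965]
-/

open scoped Manifold ContDiff Topology
open Set Function Metric

noncomputable section

namespace Literature.Topology.FourManifolds

universe u

/-! ### Flow-out input in every dimension -/

section Input

variable {n : ℕ} {M : Type u} [TopologicalSpace M] [T2Space M] [CompactSpace M]
  [ChartedSpace (EuclideanHalfSpace (n + 1)) M] [IsManifold (𝓡∂ (n + 1)) ∞ M]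

/-- **Flow-out input exists on every compact manifold with boundary** (any dimension `n + 1 ≥ 1`):
Milnor's boundary-defining function (Lemma 2.6, the tree's `exists_contMDiff_eq_one_on_boundary`,
with `f = 1 - f₁`) is `≥ 0`, vanishes exactly on `∂M` and is regular on some `{f < 2δ}`
(`exists_pos_forall_mfderiv_ne_zero`), and `exists_contMDiffSection_mlineDeriv_eq_one_on` gives `ξ`
with `ξ(f) = 1` on `{f ≤ δ}` (Milnor 1965, proof of Thm. 3.4). This is `nonempty_flowoutInput` of
`CollarTheorem.lean` without its restriction to dimension `n + 2`.
[cite: MilnorHCobordism1965, Lemma 2.6 and proof of Thm. 3.4] -/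
theorem FlowoutInput.nonempty_of_compactSpace : Nonempty (FlowoutInput n M) := by
  classical
  obtain ⟨f₁, hf₁, hbd, hint⟩ := exists_contMDiff_eq_one_on_boundary (n := n) (M := M)
  set f : M → ℝ := fun z => 1 - f₁ z with hf
  have hfs : ContMDiff (𝓡∂ (n + 1)) 𝓘(ℝ, ℝ) ∞ f :=
    ((contDiff_const (c := (1 : ℝ))).sub contDiff_id).contMDiff.comp hf₁
  have hfb : ∀ z, f z = 0 ↔ z ∈ (𝓡∂ (n + 1)).boundary M := by
    intro z
    constructor
    · intro hz
      by_contra hzb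
      have hzi : (𝓡∂ (n + 1)).IsInteriorPoint z :=
        ((𝓡∂ (n + 1)).isInteriorPoint_or_isBoundaryPoint z).resolve_right hzb
      have h := hint z hzi
      simp only [hf] at hz
      linarith
    · intro hz
      simp only [hf, (hbd z hz).1, sub_self]
  have hf0 : ∀ z, 0 ≤ f z := by
    intro z
    rcases (𝓡∂ (n + 1)).isInteriorPoint_or_isBoundaryPoint z with hzi | hzb
    · have h := hint z hzi
      simp only [hf]; linarith
    · simp only [hf, (hbd z hzb).1, sub_self, le_refl]
  have hreg : ∀ z, f z = 0 → mfderiv (𝓡∂ (n + 1)) 𝓘(ℝ, ℝ) f z ≠ 0 := by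
    intro z hz hcrit
    have hzb := (hfb z).1 hz
    have hfz : HasMFDerivAt (𝓡∂ (n + 1)) 𝓘(ℝ, ℝ) f z 0 :=
      hcrit ▸ (hfs.mdifferentiableAt (by simp)).hasMFDerivAt
    have h1 := (hasMFDerivAt_const (I := 𝓡∂ (n + 1)) (I' := 𝓘(ℝ, ℝ)) (1 : ℝ) z).sub hfz
    have heq : ((fun _ : M => (1 : ℝ)) - f) = f₁ := by
      funext x; simp [hf]
    rw [heq] at h1
    have h2 : mfderiv (𝓡∂ (n + 1)) 𝓘(ℝ, ℝ) f₁ z = 0 := by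
      rw [h1.mfderiv]; exact sub_self _
    exact (hbd z hzb).2 h2
  obtain ⟨δ', hδ', hδ'reg⟩ := exists_pos_forall_mfderiv_ne_zero hfs hf0 hreg
  set δ := δ' / 2 with hδ
  have hδpos : 0 < δ := by positivity
  have hreg2 : ∀ z ∈ {z : M | f z ≤ δ}, mfderiv (𝓡∂ (n + 1)) 𝓘(ℝ, ℝ) f z ≠ 0 := fun z hz =>
    hδ'reg z (by simp only [mem_setOf_eq] at hz; linarith)
  obtain ⟨ξ, hξ⟩ := exists_contMDiffSection_mlineDeriv_eq_one_on hfs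
    (isClosed_le hfs.continuous continuous_const) hreg2
  exact ⟨⟨f, ξ, δ, hδpos, hfs, hf0, hfb, ξ.contMDiff, fun z hz => hξ z hz⟩⟩

end Input

/-! ### The stretching `[0, ∞) ≅ [0, a)` -/

section Stretch

/-- The stretching map `s ↦ a s / (1 + s)`, `[0, ∞) → [0, a)`. [folklore] -/
def collarStretch (a s : ℝ) : ℝ := a * s / (1 + s)

/-- `collarStretch a 0 = 0`. [folklore] -/
@[simp] theorem collarStretch_zero (a : ℝ) : collarStretch a 0 = 0 := by simp [collarStretch]

/-- `collarStretch a s ≥ 0` for `a > 0`, `s ≥ 0`. [folklore] -/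
theorem collarStretch_nonneg {a s : ℝ} (ha : 0 < a) (hs : 0 ≤ s) : 0 ≤ collarStretch a s :=
  div_nonneg (mul_nonneg ha.le hs) (by linarith)

/-- `collarStretch a s < a` for `a > 0`, `s ≥ 0`. [folklore] -/
theorem collarStretch_lt {a s : ℝ} (ha : 0 < a) (hs : 0 ≤ s) : collarStretch a s < a := by
  rw [collarStretch, div_lt_iff₀ (by linarith)]
  nlinarith

/-- `collarStretch a s ∈ [0, a]` for `a > 0`, `s ≥ 0`. [folklore] -/
theorem collarStretch_mem_Icc {a s : ℝ} (ha : 0 < a) (hs : 0 ≤ s) : collarStretch a s ∈ Icc 0 a :=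
  ⟨collarStretch_nonneg ha hs, (collarStretch_lt ha hs).le⟩

/-- The inverse formula: `t / (a - t)` recovers `s` from `t = collarStretch a s`. [folklore] -/
theorem collarStretch_div_sub {a s : ℝ} (ha : 0 < a) (hs : 0 ≤ s) :
    collarStretch a s / (a - collarStretch a s) = s := by
  have h1 : (1 + s) ≠ 0 := by linarith
  have h2 : a - collarStretch a s = a / (1 + s) := by
    rw [collarStretch]; field_simp; ring
  rw [h2, collarStretch]
  field_simp

/-- The stretching of `t / (a - t)` is `t`, for `t < a`, `0 < a`. [folklore] -/
theorem collarStretch_div_sub' {a t : ℝ} (ha : 0 < a) (hta : t < a) : collarStretch a (t / (a - t)) = t := by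
  have h1 : a - t ≠ 0 := by linarith
  have h2 : 1 + t / (a - t) = a / (a - t) := by field_simp; ring
  have h3 : a ≠ 0 := ha.ne'
  rw [collarStretch, h2]
  field_simp

/-- The stretching map is smooth on `(-1, ∞)`. [folklore] -/
theorem contDiffOn_collarStretch (a : ℝ) : ContDiffOn ℝ ∞ (collarStretch a) (Ioi (-1)) := by
  refine ContDiffOn.div ?_ ?_ fun s hs => ?_
  · exact (contDiffOn_const.mul contDiffOn_id)
  · exact (contDiffOn_const.add contDiffOn_id)
  · simp only [mem_Ioi] at hs
    show (1 : ℝ) + s ≠ 0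
    linarith

/-- `t ↦ t / (a - t)` is smooth on `(-∞, a)`. [folklore] -/
theorem contDiffOn_div_sub (a : ℝ) : ContDiffOn ℝ ∞ (fun t : ℝ => t / (a - t)) (Iio a) := by
  refine ContDiffOn.div contDiffOn_id (contDiffOn_const.sub contDiffOn_id) fun t ht => ?_
  simp only [mem_Iio] at ht
  show a - t ≠ 0
  linarith

end Stretch

/-! ### The long open collar of the flow-out -/

section OpenCollar

variable {n : ℕ} {M : Type u} [TopologicalSpace M] [ChartedSpace (EuclideanHalfSpace (n + 1)) M]
  (b : BoundaryData (𝓡∂ (n + 1)) M (𝓡 n)) [Nonempty b.carrier]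
  [IsManifold (𝓡∂ (n + 1)) ∞ M] [T2Space M] {D : FlowoutInput n M} (Γ : D.Cover)

namespace FlowoutInput.Cover

omit [Nonempty b.carrier] [T2Space M] in
/-- The level of a flowed-out boundary point: `f (Fl (incl x) (collarStretch a s)) = collarStretch a s` for
`s ≥ 0`. [folklore] -/
theorem f_Fl_incl_collarStretch (x : b.carrier) {s : ℝ} (hs : 0 ≤ s) :
    D.f (Γ.Fl (b.incl x) (collarStretch Γ.a s)) = collarStretch Γ.a s := by
  have hx : D.f (b.incl x) ≤ Γ.a := by rw [D.f_incl b x]; exact Γ.a_pos.le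
  have hta : collarStretch Γ.a s ∈ Icc (-D.f (b.incl x)) Γ.a := by
    rw [D.f_incl b x, neg_zero]
    exact collarStretch_mem_Icc Γ.a_pos hs
  rw [Γ.f_Fl hx hta, D.f_incl b x, zero_add]

/-- **The long open collar of the flow-out** (`Literature.Topology.FourManifolds.BoundaryData.OpenCollar`):
`toFun x s = Fl (incl x) (a s / (1 + s))` on `∂M × [0, ∞)`, with inverse
`z ↦ (incl⁻¹ (ret z), f z / (a - f z))` on the open region `{f < a}` — Milnor's
`h(y₀, s) = ψ_{y₀}(s)`, `h⁻¹(y) = (ψ_y(0), f(y))`, with the parameter stretched to `[0, ∞)`.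
[cite: MilnorHCobordism1965, proof of Thm. 3.4] -/
def openCollar : b.OpenCollar where
  toFun x s := Γ.Fl (b.incl x) (collarStretch Γ.a s)
  proj z := b.inclInv (Γ.ret z)
  height z := D.f z / (Γ.a - D.f z)
  region := {z | D.f z < Γ.a}
  isOpen_region := isOpen_lt D.f_smooth.continuous continuous_const
  apply_zero x := by
    show Γ.Fl (b.incl x) (collarStretch Γ.a 0) = b.incl x
    rw [collarStretch_zero, Γ.Fl_zero (by rw [D.f_incl b x]; exact Γ.a_pos.le)]
  mem_region x s hs := by
    show D.f _ < Γ.a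
    rw [Γ.f_Fl_incl_collarStretch b x hs]
    exact collarStretch_lt Γ.a_pos hs
  proj_apply x s hs := by
    show b.inclInv (Γ.ret _) = x
    rw [Γ.ret_Fl (D.f_incl b x) (collarStretch_mem_Icc Γ.a_pos hs), b.inclInv_incl]
  height_apply x s hs := by
    show D.f _ / (Γ.a - D.f _) = s
    rw [Γ.f_Fl_incl_collarStretch b x hs]
    exact collarStretch_div_sub Γ.a_pos hs
  height_nonneg z hz := by
    have hz' : D.f z < Γ.a := hz
    exact div_nonneg (D.f_nonneg z) (by linarith)
  apply_proj_height z hz := by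
    have hz : D.f z < Γ.a := hz
    show Γ.Fl (b.incl (b.inclInv (Γ.ret z))) (collarStretch Γ.a (D.f z / (Γ.a - D.f z))) = z
    rw [b.incl_inclInv (Γ.ret_mem_boundary hz.le), collarStretch_div_sub' Γ.a_pos hz]
    exact Γ.Fl_ret hz.le
  contMDiffOn_toFun := by
    apply contMDiffOn_of_locally_contMDiffOn
    rintro ⟨x₀, t₀⟩ ⟨-, -⟩
    have hz₀ : D.f (b.incl x₀) ≤ Γ.a := by rw [D.f_incl b x₀]; exact Γ.a_pos.le
    obtain ⟨hy, hzd⟩ := Γ.centre_spec hz₀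
    set y := Γ.centre (b.incl x₀) with hydef
    set C := Γ.bx y hy with hC
    refine ⟨(b.incl ⁻¹' C.dom) ×ˢ univ, (C.isOpen_dom.preimage b.continuous_incl).prod isOpen_univ,
      ⟨hzd, mem_univ _⟩, ?_⟩
    -- on this piece `toFun` is the flow curve of the fixed box `C`
    have hst : ContMDiffOn 𝓘(ℝ, ℝ) 𝓘(ℝ, ℝ) ∞ (collarStretch Γ.a) (Ici 0) :=
      (contDiffOn_collarStretch Γ.a).contMDiffOn.mono fun s hs => by
        simp only [mem_Ici] at hs; simp only [mem_Ioi]; linarith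
    have hinner : ContMDiffOn ((𝓡 n).prod 𝓘(ℝ, ℝ)) ((𝓡∂ (n + 1)).prod 𝓘(ℝ, ℝ)) ∞
        (fun p : b.carrier × ℝ => (b.incl p.1, collarStretch Γ.a p.2))
        ((univ ×ˢ Ici (0 : ℝ)) ∩ (b.incl ⁻¹' C.dom) ×ˢ univ) := by
      refine ContMDiffOn.prodMk ?_ ?_
      · exact b.isSmoothEmbedding.contMDiff.comp_contMDiffOn contMDiffOn_fst
      · exact hst.comp contMDiffOn_snd fun p hp => hp.1.2
    have hcomp := (Γ.contMDiffOn_curve y hy).comp hinner fun p hp => by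
        refine ⟨hp.2.1, ?_⟩
        have ha := Γ.a_le_ε y hy
        have h := collarStretch_mem_Icc Γ.a_pos (s := p.2) hp.1.2
        exact ⟨h.1, h.2.trans ha⟩
    refine hcomp.congr fun p hp => ?_
    have hx : D.f (b.incl p.1) ≤ Γ.a := by rw [D.f_incl b p.1]; exact Γ.a_pos.le
    show Γ.Fl (b.incl p.1) (collarStretch Γ.a p.2) = C.curve (b.incl p.1) (collarStretch Γ.a p.2)
    refine Γ.Fl_eq_of_mem_dom hy hx hp.2.1 ?_
    rw [D.f_incl b p.1, neg_zero]
    exact collarStretch_mem_Icc Γ.a_pos hp.1.2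
  contMDiffOn_proj := by
    apply contMDiffOn_of_locally_contMDiffOn
    intro z₀ hz₀
    have hz₀' : D.f z₀ ≤ Γ.a := le_of_lt hz₀
    obtain ⟨hy, hzd⟩ := Γ.centre_spec hz₀'
    set y := Γ.centre z₀ with hydef
    set C := Γ.bx y hy with hC
    refine ⟨C.dom, C.isOpen_dom, hzd, ?_⟩
    have h1 : ContMDiffOn (𝓡∂ (n + 1)) (𝓡∂ (n + 1)) ∞ (fun z => C.curve z (-D.f z))
        ({z | D.f z < Γ.a} ∩ C.dom) :=
      (Γ.contMDiffOn_curve_neg y hy).mono fun z hz => ⟨hz.2, lt_of_lt_of_le hz.1 (Γ.a_le_ε y hy)⟩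
    have h2 := b.contMDiffOn_inclInv.comp h1 fun z hz => by
      show C.curve z (-D.f z) ∈ range b.incl
      rw [b.range_incl, ← Γ.Fl_eq_of_mem_dom hy (le_of_lt hz.1) hz.2
        ⟨le_rfl, by linarith [D.f_nonneg z, Γ.a_pos]⟩]
      exact Γ.ret_mem_boundary (le_of_lt hz.1)
    refine h2.congr fun z hz => ?_
    show b.inclInv (Γ.ret z) = b.inclInv (C.curve z (-D.f z))
    rw [ret, Γ.Fl_eq_of_mem_dom hy (le_of_lt hz.1) hz.2 ⟨le_rfl, by linarith [D.f_nonneg z, Γ.a_pos]⟩]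
  contMDiffOn_height :=
    (contDiffOn_div_sub Γ.a).contMDiffOn.comp D.f_smooth.contMDiffOn fun z hz => hz

end FlowoutInput.Cover

/-- **Long open collars exist on compact manifolds with (nonempty) boundary, in every dimension
`n + 1 ≥ 1`.** Bröcker–Jänich (1982), (13.6); Milnor (1965), proof of Thm. 3.4 (flow-out of a
boundary-defining function along a unit-speed field, `FlowoutInput.nonempty_of_compactSpace`,
`FlowoutInput.nonempty_cover`, `FlowoutInput.Cover.openCollar`). [cite: BrockerJanich1982, (13.6)] -/
theorem BoundaryData.nonempty_openCollar [CompactSpace M] : Nonempty b.OpenCollar := by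
  obtain ⟨D⟩ := FlowoutInput.nonempty_of_compactSpace (n := n) (M := M)
  obtain ⟨Γ⟩ := D.nonempty_cover
  exact ⟨Γ.openCollar b⟩

end OpenCollar

end Literature.Topology.FourManifolds
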